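import Summits.CriticalPhenomena.PercolationContinuityZ3.Theorems.PercNearOneGluingNoHeavyLowerTailTwoLevelLonelyRelayTools
import HarnessLib

/-!
# `NoHeavyLowerTail` (stmt-CriticalPhenomena-4575) — two-level lonely relay theorem, LOSS side

Support file (factory prove seat `prim-ineq-prove-3`, gen 3; `--supports stmt-CriticalPhenomena-4575`).  No
definitions, no named facts.  Step (a) of the two-level lonely relay theorem (`…TwoLevelLonelyRelay.lean`):
`μ = prodBernoulli w` on `Fin n`, observer `o`, relays `A` split into halves `B`, `A ∖ B`, designated singletons
`L` with far sides `far u` (the other half), `φ_r = P(o ↔ r | r ↮ A∖r)`, `Λ = {C(o)∩A ∈ 𝓛}`,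
`𝓛 = {B, A∖B} ∪ {{u} : u ∈ L}`.
* `loss_term` — `μ({r ↮ A∖r} ∩ {o↔r} ∩ {u ↔ far u}) ≤ φ_r · μ({r ↮ A∖r} ∩ {u ↔ far u})` (two-set BHK,
  negative correlation of `{o ↔ r}` on `C_r` and `{u ↔ far u}` on `C_{A∖r}` given `{r ↮ A∖r}`);
* `loss_le` — `μ(Λ ∩ {u ↔ far u}) ≤ Σ_{r ≠ u} φ_r · μ({r ↮ A∖r} ∩ {u ↔ far u})`: on `Λ ∩ {u ↔ far u}` the
  captured set is a designated singleton `{r}`, `r ≠ u`;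
* bookkeeping: `far_facts`, `filter_eq_singleton_subset`, `roots_subset_sep`.
-/

namespace Summit.CriticalPhenomena.PercolationContinuityZ3.Theorems

open scoped BigOperators Classical Topology
open MeasureTheory Set Filter
open Literature.Probability.LatticeModels (prodBernoulli)
open Literature.Probability.Percolation

variable {n : ℕ}

namespace TwoLevelLonelyRelay

/-- `{u ↔ Far}` read off `C_T` for `u ∈ T`. [folklore] -/
theorem reachSet_pred_eq (u : Fin n) (T Far : Finset (Fin n)) (hu : u ∈ T) :
    {ω : BondConfig (Fin n) | ∃ b ∈ Far, (SimpleGraph.fromEdgeSet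
        (⋃ t ∈ (↑T : Set (Fin n)), openEdgeCluster ω t)).Reachable u b} =
      {ω | ∃ b ∈ Far, ω ∈ openConn u b} := by
  ext ω; simp only [Set.mem_setOf_eq]
  constructor
  · rintro ⟨b, hb, h⟩
    exact ⟨b, hb, (reachable_clusterUnion_iff ω _ (Finset.mem_coe.2 hu) b).1 h⟩
  · rintro ⟨b, hb, h⟩
    exact ⟨b, hb, (reachable_clusterUnion_iff ω _ (Finset.mem_coe.2 hu) b).2 h⟩

/-- `{u ↮ A∖u}` as a two-set separation event with source `{u}`. [folklore] -/
theorem sep_singleton_eq (A : Finset (Fin n)) (u : Fin n) :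
    {ω : BondConfig (Fin n) | ∀ s ∈ ({u} : Set (Fin n)), ∀ t ∈ (↑(A.erase u) : Set (Fin n)),
        ¬ (openGraph ω).Reachable s t} = {ω | ∀ y ∈ A.erase u, ω ∉ openConn u y} := by
  ext ω
  simp only [Set.mem_setOf_eq, Set.mem_singleton_iff, forall_eq, Finset.mem_coe]
  exact Iff.rfl

/-- **Loss term** (step (a) of the two-level lonely relay theorem).  For relays `r ≠ u`, a far side `Far`
of `u`, `D_r = {r ↮ A∖r}` non-null and `φ_r = μ(D_r ∩ {o↔r})/μ(D_r)`:
`μ(D_r ∩ ({o ↔ r} ∩ {u ↔ Far})) ≤ φ_r · μ(D_r ∩ {u ↔ Far})` — 'o holds the isolated relay r while u reaches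
its far side' is charged to `φ_r`, by two-set BHK negative correlation given `{r ↮ A∖r}`.
[cite: VandenbergHaggstromKahn2005, Thm. 1.4 with sets — corollary] -/
theorem loss_term (w : Sym2 (Fin n) → unitInterval) (A Far : Finset (Fin n)) (o r u : Fin n)
    (hu : u ∈ A.erase r) (hpos : 0 < (prodBernoulli w).real {ω | ∀ y ∈ A.erase r, ω ∉ openConn r y}) :
    (prodBernoulli w).real ({ω | ∀ y ∈ A.erase r, ω ∉ openConn r y} ∩
        (openConn o r ∩ {ω | ∃ b ∈ Far, ω ∈ openConn u b})) ≤
      (prodBernoulli w).real ({ω | ∀ y ∈ A.erase r, ω ∉ openConn r y} ∩ openConn o r) /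
          (prodBernoulli w).real {ω | ∀ y ∈ A.erase r, ω ∉ openConn r y} *
        (prodBernoulli w).real ({ω | ∀ y ∈ A.erase r, ω ∉ openConn r y} ∩
          {ω | ∃ b ∈ Far, ω ∈ openConn u b}) := by
  have key := twoSet_neg w ({r} : Set (Fin n)) (↑(A.erase r) : Set (Fin n))
    (fun C => (SimpleGraph.fromEdgeSet C).Reachable r o)
    (fun E => ∃ b ∈ Far, (SimpleGraph.fromEdgeSet E).Reachable u b)
    (fun C C' hCC' h => reachable_fromEdgeSet_mono hCC' h)
    (fun E E' hEE' ⟨b, hb, h⟩ => ⟨b, hb, reachable_fromEdgeSet_mono hEE' h⟩)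
  rw [sep_singleton_eq, conn_pred_eq, reachSet_pred_eq u (A.erase r) Far hu] at key
  rw [div_mul_eq_mul_div, le_div_iff₀ hpos]
  calc (prodBernoulli w).real ({ω | ∀ y ∈ A.erase r, ω ∉ openConn r y} ∩
          (openConn o r ∩ {ω | ∃ b ∈ Far, ω ∈ openConn u b})) *
        (prodBernoulli w).real {ω | ∀ y ∈ A.erase r, ω ∉ openConn r y}
      = (prodBernoulli w).real {ω | ∀ y ∈ A.erase r, ω ∉ openConn r y} *
          (prodBernoulli w).real ({ω | ∀ y ∈ A.erase r, ω ∉ openConn r y} ∩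
            (openConn o r ∩ {ω | ∃ b ∈ Far, ω ∈ openConn u b})) := mul_comm _ _
    _ ≤ _ := key

/-- Bookkeeping for the far side: `far r` is the other half, so `r ∈ A`, `far r ⊆ A∖r`, and every `b ∈ far r`
lies on the other side of the bipartition. [folklore] -/
theorem far_facts (A B L : Finset (Fin n)) (far : Fin n → Finset (Fin n)) (hBA : B ⊆ A)
    (hL : ∀ r ∈ L, (r ∈ B ∧ far r = A \ B) ∨ (r ∈ A \ B ∧ far r = B)) {r : Fin n} (hr : r ∈ L) :
    r ∈ A ∧ far r ⊆ A.erase r ∧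
      ∀ b ∈ far r, (r ∈ B ∧ b ∈ A \ B) ∨ (r ∈ A \ B ∧ b ∈ B) := by
  rcases hL r hr with ⟨hrB, hfar⟩ | ⟨hrB, hfar⟩
  · refine ⟨hBA hrB, fun b hb => ?_, fun b hb => Or.inl ⟨hrB, hfar ▸ hb⟩⟩
    rw [hfar] at hb
    exact Finset.mem_erase.2 ⟨fun h => (Finset.mem_sdiff.1 hb).2 (h ▸ hrB), (Finset.mem_sdiff.1 hb).1⟩
  · refine ⟨(Finset.mem_sdiff.1 hrB).1, fun b hb => ?_, fun b hb => Or.inr ⟨hrB, hfar ▸ hb⟩⟩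
    rw [hfar] at hb
    exact Finset.mem_erase.2 ⟨fun h => (Finset.mem_sdiff.1 hrB).2 (h ▸ hb), hBA hb⟩

/-- `{C(o) ∩ A = {r}} ⊆ {r ↮ A∖r} ∩ {o ↔ r}`. [folklore] -/
theorem filter_eq_singleton_subset (A : Finset (Fin n)) (o r : Fin n) :
    {ω : BondConfig (Fin n) | A.filter (fun a => ω ∈ openConn o a) = {r}} ⊆
      {ω | ∀ y ∈ A.erase r, ω ∉ openConn r y} ∩ openConn o r := by
  intro ω hω
  have hrF : r ∈ A.filter (fun a => ω ∈ openConn o a) := by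
    rw [show A.filter (fun a => ω ∈ openConn o a) = {r} from hω]; exact Finset.mem_singleton_self r
  have hor : ω ∈ openConn o r := (Finset.mem_filter.1 hrF).2
  refine ⟨fun y hy hry => ?_, hor⟩
  have hyF : y ∈ A.filter (fun a => ω ∈ openConn o a) :=
    Finset.mem_filter.2 ⟨(Finset.mem_erase.1 hy).2, (hor : (openGraph ω).Reachable o r).trans hry⟩
  rw [show A.filter (fun a => ω ∈ openConn o a) = {r} from hω, Finset.mem_singleton] at hyF
  exact (Finset.mem_erase.1 hy).1 hyF

/-- **Loss bound** (step (a)): for a designated singleton `u` with far side `far u`,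
`μ(Λ ∩ {u ↔ far u}) ≤ Σ_{r ≠ u} φ_r · μ({r ↮ A∖r} ∩ {u ↔ far u})`, where `Λ = {C(o) ∩ A ∈ 𝓛}`: on `Λ ∩ {u ↔ far u}`
the captured set is a designated singleton `{r}`, `r ≠ u` (the two halves and `{u}` are incompatible with
`u ↔ far u`), and each such term is charged by `loss_term`.
[cite: KozmaNitzan2024, Lemma 2 (p. 6) — mechanism; VandenbergHaggstromKahn2005, Thm. 1.4] -/
theorem loss_le (w : Sym2 (Fin n) → unitInterval) (A B L : Finset (Fin n)) (far : Fin n → Finset (Fin n))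
    (o u : Fin n) (hBA : B ⊆ A)
    (hL : ∀ r ∈ L, (r ∈ B ∧ far r = A \ B) ∨ (r ∈ A \ B ∧ far r = B)) (hu : u ∈ L)
    (hpos : 0 < (prodBernoulli w).real
      {ω : BondConfig (Fin n) | ∀ x ∈ A, ∀ y ∈ A, x ≠ y → ω ∉ openConn x y}) :
    (prodBernoulli w).real ({ω | A.filter (fun a => ω ∈ openConn o a) = B ∨
          A.filter (fun a => ω ∈ openConn o a) = A \ B ∨
          ∃ r ∈ L, A.filter (fun a => ω ∈ openConn o a) = {r}} ∩ {ω | ∃ b ∈ far u, ω ∈ openConn u b}) ≤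
      ∑ r ∈ L.erase u, (prodBernoulli w).real ({ω | ∀ y ∈ A.erase r, ω ∉ openConn r y} ∩ openConn o r) /
          (prodBernoulli w).real {ω | ∀ y ∈ A.erase r, ω ∉ openConn r y} *
        (prodBernoulli w).real ({ω | ∀ y ∈ A.erase r, ω ∉ openConn r y} ∩
          {ω | ∃ b ∈ far u, ω ∈ openConn u b}) := by
  set μ := prodBernoulli w with hμ
  set Kc : Set (BondConfig (Fin n)) := {ω | ∃ b ∈ far u, ω ∈ openConn u b} with hKc
  obtain ⟨huA, hfaru, hfarb⟩ := far_facts A B L far hBA hL hu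
  -- (a1) cover
  have hcover : {ω | A.filter (fun a => ω ∈ openConn o a) = B ∨
          A.filter (fun a => ω ∈ openConn o a) = A \ B ∨
          ∃ r ∈ L, A.filter (fun a => ω ∈ openConn o a) = {r}} ∩ Kc ⊆
      ⋃ r ∈ L.erase u, ({ω | A.filter (fun a => ω ∈ openConn o a) = {r}} ∩ Kc) := by
    rintro ω ⟨hΛ, hK⟩
    obtain ⟨b, hb, hub⟩ := hK
    have hub' : (openGraph ω).Reachable u b := hub
    rcases hΛ with hF | hF | ⟨r, hr, hF⟩
    · exfalso
      rcases hfarb b hb with ⟨huB, hbB⟩ | ⟨huB, hbB⟩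
      · have huF : u ∈ A.filter (fun a => ω ∈ openConn o a) := by rw [hF]; exact huB
        have hbF : b ∈ A.filter (fun a => ω ∈ openConn o a) := Finset.mem_filter.2
          ⟨(Finset.mem_sdiff.1 hbB).1, ((Finset.mem_filter.1 huF).2 : (openGraph ω).Reachable o u).trans hub'⟩
        rw [hF] at hbF; exact (Finset.mem_sdiff.1 hbB).2 hbF
      · have hbF : b ∈ A.filter (fun a => ω ∈ openConn o a) := by rw [hF]; exact hbB
        have huF : u ∈ A.filter (fun a => ω ∈ openConn o a) := Finset.mem_filter.2
          ⟨huA, ((Finset.mem_filter.1 hbF).2 : (openGraph ω).Reachable o b).trans hub'.symm⟩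
        rw [hF] at huF; exact (Finset.mem_sdiff.1 huB).2 huF
    · exfalso
      rcases hfarb b hb with ⟨huB, hbB⟩ | ⟨huB, hbB⟩
      · have hbF : b ∈ A.filter (fun a => ω ∈ openConn o a) := by rw [hF]; exact hbB
        have huF : u ∈ A.filter (fun a => ω ∈ openConn o a) := Finset.mem_filter.2
          ⟨huA, ((Finset.mem_filter.1 hbF).2 : (openGraph ω).Reachable o b).trans hub'.symm⟩
        rw [hF] at huF; exact (Finset.mem_sdiff.1 huF).2 huB
      · have huF : u ∈ A.filter (fun a => ω ∈ openConn o a) := by rw [hF]; exact huB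
        have hbF : b ∈ A.filter (fun a => ω ∈ openConn o a) := Finset.mem_filter.2
          ⟨hBA hbB, ((Finset.mem_filter.1 huF).2 : (openGraph ω).Reachable o u).trans hub'⟩
        rw [hF] at hbF; exact (Finset.mem_sdiff.1 hbF).2 hbB
    · have hru : r ≠ u := by
        rintro rfl
        have huF : r ∈ A.filter (fun a => ω ∈ openConn o a) := by rw [hF]; exact Finset.mem_singleton_self r
        have hbF : b ∈ A.filter (fun a => ω ∈ openConn o a) := Finset.mem_filter.2
          ⟨(Finset.mem_erase.1 (hfaru hb)).2,
            ((Finset.mem_filter.1 huF).2 : (openGraph ω).Reachable o r).trans hub'⟩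
        rw [hF, Finset.mem_singleton] at hbF
        exact (Finset.mem_erase.1 (hfaru hb)).1 hbF
      exact Set.mem_iUnion₂.2 ⟨r, Finset.mem_erase.2 ⟨hru, hr⟩, hF, b, hb, hub⟩
  -- (a2) + (a3) termwise
  have hterm : ∀ r ∈ L.erase u,
      μ.real ({ω | A.filter (fun a => ω ∈ openConn o a) = {r}} ∩ Kc) ≤
        μ.real ({ω | ∀ y ∈ A.erase r, ω ∉ openConn r y} ∩ openConn o r) /
            μ.real {ω | ∀ y ∈ A.erase r, ω ∉ openConn r y} *
          μ.real ({ω | ∀ y ∈ A.erase r, ω ∉ openConn r y} ∩ Kc) := by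
    intro r hr
    obtain ⟨hru, hrL⟩ := Finset.mem_erase.1 hr
    have hrA : r ∈ A := (far_facts A B L far hBA hL hrL).1
    have hsub : {ω | A.filter (fun a => ω ∈ openConn o a) = {r}} ∩ Kc ⊆
        {ω | ∀ y ∈ A.erase r, ω ∉ openConn r y} ∩ (openConn o r ∩ Kc) := by
      rintro ω ⟨hF, hK⟩
      obtain ⟨h1, h2⟩ := filter_eq_singleton_subset A o r hF
      exact ⟨h1, h2, hK⟩
    have hposr : 0 < μ.real {ω | ∀ y ∈ A.erase r, ω ∉ openConn r y} := by
      refine lt_of_lt_of_le hpos (measureReal_mono fun ω hω y hy => ?_)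
      exact hω r hrA y (Finset.mem_erase.1 hy).2 (fun h => (Finset.mem_erase.1 hy).1 h.symm)
    exact (measureReal_mono hsub).trans
      (loss_term w A (far u) o r u (Finset.mem_erase.2 ⟨hru.symm, huA⟩) hposr)
  calc μ.real ({ω | A.filter (fun a => ω ∈ openConn o a) = B ∨
          A.filter (fun a => ω ∈ openConn o a) = A \ B ∨
          ∃ r ∈ L, A.filter (fun a => ω ∈ openConn o a) = {r}} ∩ Kc)
      ≤ μ.real (⋃ r ∈ L.erase u, ({ω | A.filter (fun a => ω ∈ openConn o a) = {r}} ∩ Kc)) :=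
        measureReal_mono hcover (measure_ne_top _ _)
    _ ≤ ∑ r ∈ L.erase u, μ.real ({ω | A.filter (fun a => ω ∈ openConn o a) = {r}} ∩ Kc) :=
        measureReal_biUnion_finset_le _ _
    _ ≤ _ := Finset.sum_le_sum hterm

/-- The two root events lie in `{B ↮ A∖B}`. [folklore] -/
theorem roots_subset_sep (A B : Finset (Fin n)) (hBA : B ⊆ A) (o : Fin n) :
    {ω : BondConfig (Fin n) | A.filter (fun a => ω ∈ openConn o a) = B ∨
        A.filter (fun a => ω ∈ openConn o a) = A \ B} ⊆
      {ω | ∀ b ∈ B, ∀ b' ∈ A \ B, ω ∉ openConn b b'} := by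
  rintro ω (hF | hF) b hb b' hb' hbb'
  · have hbF : b ∈ A.filter (fun a => ω ∈ openConn o a) := by rw [hF]; exact hb
    have hb'F : b' ∈ A.filter (fun a => ω ∈ openConn o a) := Finset.mem_filter.2
      ⟨(Finset.mem_sdiff.1 hb').1, ((Finset.mem_filter.1 hbF).2 : (openGraph ω).Reachable o b).trans hbb'⟩
    rw [hF] at hb'F; exact (Finset.mem_sdiff.1 hb').2 hb'F
  · have hb'F : b' ∈ A.filter (fun a => ω ∈ openConn o a) := by rw [hF]; exact hb'
    have hbF : b ∈ A.filter (fun a => ω ∈ openConn o a) := Finset.mem_filter.2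
      ⟨hBA hb, ((Finset.mem_filter.1 hb'F).2 : (openGraph ω).Reachable o b').trans
        (SimpleGraph.Reachable.symm hbb')⟩
    rw [hF] at hbF; exact (Finset.mem_sdiff.1 hbF).2 hb

end TwoLevelLonelyRelay

end Summit.CriticalPhenomena.PercolationContinuityZ3.Theorems
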